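import Literature.AnabelianGeometry.SemiGraphs.QuasiTemperoidsRmkA31Model
import Literature.AnabelianGeometry.SemiGraphs.TemperoidsCountablyConnectedTransport
import Mathlib.CategoryTheory.Limits.Preserves.Shapes.Equalizers
import Mathlib.CategoryTheory.Limits.Preserves.Shapes.Pullbacks
import Mathlib.CategoryTheory.Limits.Preserves.Shapes.BinaryProducts
import Mathlib.CategoryTheory.Adjunction.Limits
import Mathlib.CategoryTheory.Functor.EpiMono
import HarnessLib

/-!
# Semi-graphs of anabelioids, Appendix: Remark A.3.1 (proofs, part 2)

Mochizuki, *Semi-graphs of anabelioids*, Publ. RIMS **42** (2006) 221–322, Appendix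
"Quasi-temperoids", Remark A.3.1, manuscript p. 82 [cite: MochizukiSemiAnbd2006, Rmk A.3.1 p.82]:
"(a) `(A, Γ_A) → (B, Γ_B)` is 0-proper. (b) `A → B` is an epimorphism. (c) `B` is the colimit of the
two projections `A ×_B A → A`. — equivalent."  Proof-only companion (no definitions) of
`QuasiTemperoidsQDPairs.lean` (abc-iut-L3-t2): the named fact `RmkA31` is DISCHARGED
(`rmkA31_holds`).

* In the model `B^temp(Π, Π°)` (continuing `QuasiTemperoidsRmkA31Model.lean`): the kernel pair
  `{(x, x′) | f x = f x′} ⊆ X × X` of an arrow is an object over `Π/Π°` and a limit pullback cone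
  (`exists_kernelPair`); a surjective arrow is the coequalizer of (every limit cone of) its kernel
  pair (`isColimit_cofork_of_surjective`), whence (b) ⟺ (c) in the model
  (`epi_iff_forall_isColimit_cofork`).
* Transport along the chart `Q ≌ B^temp(Π, Π°)` of a connected quasi-temperoid: components,
  0-properness, epimorphisms, limit kernel-pair cones and their coforks are preserved and reflected
  by an equivalence (`IsComponent.map_equivalence`, …), which assembles `rmkA31_holds`.

Nothing here bears on [IUTchIII] Cor. 3.12.
-/

open CategoryTheory CategoryTheory.Limits Topology

namespace Literature.AnabelianGeometry.SemiGraphs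

namespace RmkA31Model

open Literature.AlgebraicGeometry.Frobenioids (IsConnectedObj IsNonemptyObj)
open Literature.AlgebraicGeometry.Frobenioids.QuasiTemperoid (BTempRel cosetAction)
open Literature.AlgebraicGeometry.Frobenioids.QuasiTemperoid.BTempRel (hom_ρ hom_ext_apply
  ρ_one_apply ρ_mul_apply ρ_inv_apply)

universe u

variable {G : Type u} [Group G] [TopologicalSpace G] {H : Subgroup G}

/-! ### The kernel pair of an arrow of `B^temp(Π, Π°)` -/

/-- **The kernel pair** `A ×_B A = {(x, x′) | f x = f x′}` of an arrow `f : A → B` of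
`B^temp(Π, Π°)`: a countable `Π`-set (diagonal action) over `Π/Π°` (through the first projection)
whose two projections form a LIMIT pullback cone, and which covers the kernel relation of `f`.
[cite: MochizukiSemiAnbd2006, Rmk A.3.1 p.82] -/
theorem exists_kernelPair {X Y : BTempRel G H} (f : X ⟶ Y) :
    ∃ (K : BTempRel G H) (p q : K ⟶ X) (w : p ≫ f = q ≫ f),
      Nonempty (IsLimit (PullbackCone.mk p q w)) ∧
      ∀ x x' : X.obj.obj.V, (f.hom.hom.hom x : Y.obj.obj.V) = f.hom.hom.hom x' →
        ∃ k : K.obj.obj.V, (p.hom.hom.hom k : X.obj.obj.V) = x ∧ (q.hom.hom.hom k : X.obj.obj.V) = x' := by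
  letI : MulAction G X.obj.obj.V := Action.instMulAction X.obj.obj
  obtain ⟨t⟩ := X.property
  -- the kernel relation as a sub-`Π`-set of `X × X`
  let S : SubMulAction G (X.obj.obj.V × X.obj.obj.V) :=
    { carrier := {z | (f.hom.hom.hom z.1 : Y.obj.obj.V) = f.hom.hom.hom z.2}
      smul_mem' := fun g {z} hz => by
        change (f.hom.hom.hom (g • z.1) : Y.obj.obj.V) = f.hom.hom.hom (g • z.2)
        change (f.hom.hom.hom (X.obj.obj.ρ g z.1) : Y.obj.obj.V) = f.hom.hom.hom (X.obj.obj.ρ g z.2)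
        rw [hom_ρ, hom_ρ]
        exact congrArg (Y.obj.obj.ρ g) hz }
  let KA : Action (Type u) G := { V := S, ρ := (Action.ofMulAction G S).ρ }
  let K : BTempRel G H :=
    ⟨⟨KA, by
      haveI : Countable X.obj.obj.V := X.obj.property.1
      refine ⟨inferInstanceAs (Countable S), fun (z : S) => ?_⟩
      change IsOpen {g : G | (Action.ofMulAction G S).ρ g z = z}
      have : {g : G | (Action.ofMulAction G S).ρ g z = z} =
          {g : G | X.obj.obj.ρ g z.1.1 = z.1.1} ∩ {g : G | X.obj.obj.ρ g z.1.2 = z.1.2} := by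
        ext g
        simp only [Set.mem_setOf_eq, Set.mem_inter_iff]
        change g • z = z ↔ g • z.1.1 = z.1.1 ∧ g • z.1.2 = z.1.2
        rw [Subtype.ext_iff, SubMulAction.val_smul, Prod.ext_iff, Prod.smul_fst, Prod.smul_snd]
      rw [this]
      exact (X.obj.property.2 z.1.1).inter (X.obj.property.2 z.1.2)⟩,
      ⟨{ hom := TypeCat.ofHom fun z : S => t.hom z.1.1
         comm := fun g => by
            apply ConcreteCategory.hom_ext
            intro z
            change t.hom (g • z.1.1) = (cosetAction G H).ρ g (t.hom z.1.1)
            exact ConcreteCategory.congr_hom (t.comm g) z.1.1 }⟩⟩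
  let p : K ⟶ X := ObjectProperty.homMk (ObjectProperty.homMk
    { hom := TypeCat.ofHom fun z : S => z.1.1
      comm := fun g => by
        apply ConcreteCategory.hom_ext
        intro z
        rfl })
  let q : K ⟶ X := ObjectProperty.homMk (ObjectProperty.homMk
    { hom := TypeCat.ofHom fun z : S => z.1.2
      comm := fun g => by
        apply ConcreteCategory.hom_ext
        intro z
        rfl })
  have w : p ≫ f = q ≫ f := hom_ext_apply fun z => z.2
  refine ⟨K, p, q, w, ⟨PullbackCone.IsLimit.mk w
      (fun s => ObjectProperty.homMk (ObjectProperty.homMk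
        { hom := TypeCat.ofHom fun v : s.pt.obj.obj.V =>
            (⟨(s.fst.hom.hom.hom v, s.snd.hom.hom.hom v),
              congrArg (fun φ : s.pt ⟶ Y => (φ.hom.hom.hom v : Y.obj.obj.V)) s.condition⟩ : S)
          comm := fun g => ?_ }))
      (fun s => hom_ext_apply fun _ => rfl) (fun s => hom_ext_apply fun _ => rfl)
      (fun s m h₁ h₂ => hom_ext_apply fun v => Subtype.ext (Prod.ext
        (congrArg (fun φ : s.pt ⟶ X => (φ.hom.hom.hom v : X.obj.obj.V)) h₁)
        (congrArg (fun φ : s.pt ⟶ X => (φ.hom.hom.hom v : X.obj.obj.V)) h₂)))⟩,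
    fun x x' hxx' => ⟨⟨(x, x'), hxx'⟩, rfl, rfl⟩⟩
  apply ConcreteCategory.hom_ext
  intro v
  apply Subtype.ext
  change (s.fst.hom.hom.hom (s.pt.obj.obj.ρ g v), s.snd.hom.hom.hom (s.pt.obj.obj.ρ g v)) =
    g • (s.fst.hom.hom.hom v, s.snd.hom.hom.hom v)
  rw [hom_ρ, hom_ρ]
  rfl

/-- **A surjective arrow of `B^temp(Π, Π°)` is the coequalizer of its kernel pair** — of ANY limit
pullback cone of the arrow against itself (all such cover the kernel relation, through the honest
kernel pair): a map out of `X` that equalises the two projections is constant on the fibres of `f`,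
hence descends (equivariantly) along the surjection `f`, uniquely.
[cite: MochizukiSemiAnbd2006, Rmk A.3.1 p.82] -/
theorem isColimit_cofork_of_surjective {X Y : BTempRel G H} (f : X ⟶ Y)
    (hf : Function.Surjective fun x : X.obj.obj.V => (f.hom.hom.hom x : Y.obj.obj.V))
    (c : PullbackCone f f) (hc : IsLimit c) : Nonempty (IsColimit (Cofork.ofπ f c.condition)) := by
  classical
  obtain ⟨K, p, q, w, -, hcover⟩ := exists_kernelPair f
  -- `c` covers the kernel relation, through the honest kernel pair
  let l : K ⟶ c.pt := hc.lift (PullbackCone.mk p q w)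
  have hl₁ : l ≫ c.fst = p := hc.fac (PullbackCone.mk p q w) WalkingCospan.left
  have hl₂ : l ≫ c.snd = q := hc.fac (PullbackCone.mk p q w) WalkingCospan.right
  have hcov : ∀ x x' : X.obj.obj.V, (f.hom.hom.hom x : Y.obj.obj.V) = f.hom.hom.hom x' →
      ∃ v : c.pt.obj.obj.V, (c.fst.hom.hom.hom v : X.obj.obj.V) = x ∧
        (c.snd.hom.hom.hom v : X.obj.obj.V) = x' := by
    intro x x' h
    obtain ⟨k, hk₁, hk₂⟩ := hcover x x' h
    refine ⟨l.hom.hom.hom k, ?_, ?_⟩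
    · change ((l ≫ c.fst).hom.hom.hom k : X.obj.obj.V) = x
      rw [hl₁, hk₁]
    · change ((l ≫ c.snd).hom.hom.hom k : X.obj.obj.V) = x'
      rw [hl₂, hk₂]
  -- a section of `f`
  let σ : Y.obj.obj.V → X.obj.obj.V := fun y => (hf y).choose
  have hσ : ∀ y, (f.hom.hom.hom (σ y) : Y.obj.obj.V) = y := fun y => (hf y).choose_spec
  refine ⟨Cofork.IsColimit.mk _
    (fun s => ObjectProperty.homMk (ObjectProperty.homMk
      { hom := TypeCat.ofHom fun y : Y.obj.obj.V => (s.π.hom.hom.hom (σ y) : s.pt.obj.obj.V)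
        comm := fun g => ?_ }))
    (fun s => ?_) (fun s m hm => ?_)⟩
  · -- maps equalising the kernel pair are constant on fibres
    have hconst : ∀ x x' : X.obj.obj.V, (f.hom.hom.hom x : Y.obj.obj.V) = f.hom.hom.hom x' →
        (s.π.hom.hom.hom x : s.pt.obj.obj.V) = s.π.hom.hom.hom x' := by
      intro x x' h
      obtain ⟨v, hv₁, hv₂⟩ := hcov x x' h
      rw [← hv₁, ← hv₂]
      change ((c.fst ≫ s.π).hom.hom.hom v : s.pt.obj.obj.V) = (c.snd ≫ s.π).hom.hom.hom v
      rw [s.condition]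
    apply ConcreteCategory.hom_ext
    intro y
    change (s.π.hom.hom.hom (σ (Y.obj.obj.ρ g y)) : s.pt.obj.obj.V) =
      s.pt.obj.obj.ρ g (s.π.hom.hom.hom (σ y))
    rw [← hom_ρ]
    apply hconst
    rw [hσ, hom_ρ, hσ]
  · have hconst : ∀ x x' : X.obj.obj.V, (f.hom.hom.hom x : Y.obj.obj.V) = f.hom.hom.hom x' →
        (s.π.hom.hom.hom x : s.pt.obj.obj.V) = s.π.hom.hom.hom x' := by
      intro x x' h
      obtain ⟨v, hv₁, hv₂⟩ := hcov x x' h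
      rw [← hv₁, ← hv₂]
      change ((c.fst ≫ s.π).hom.hom.hom v : s.pt.obj.obj.V) = (c.snd ≫ s.π).hom.hom.hom v
      rw [s.condition]
    apply hom_ext_apply
    intro x
    change (s.π.hom.hom.hom (σ (f.hom.hom.hom x)) : s.pt.obj.obj.V) = s.π.hom.hom.hom x
    exact hconst _ _ (hσ _)
  · apply hom_ext_apply
    intro y
    change (m.hom.hom.hom y : s.pt.obj.obj.V) = s.π.hom.hom.hom (σ y)
    conv_lhs => rw [← hσ y]
    exact congrArg (fun φ : X ⟶ s.pt => (φ.hom.hom.hom (σ y) : s.pt.obj.obj.V)) hm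

/-- **Remark A.3.1, (b) ⟺ (c), in the model `B^temp(Π, Π°)`**: an arrow is an epimorphism iff it
is the colimit of the two projections from (every limit cone of) its kernel pair.
[cite: MochizukiSemiAnbd2006, Rmk A.3.1 p.82] -/
theorem epi_iff_forall_isColimit_cofork {X Y : BTempRel G H} (f : X ⟶ Y) :
    Epi f ↔ ∀ c : PullbackCone f f, IsLimit c → Nonempty (IsColimit (Cofork.ofπ f c.condition)) := by
  constructor
  · intro hf c hc
    exact isColimit_cofork_of_surjective f (surjective_of_epi f) c hc
  · intro h
    obtain ⟨K, p, q, w, ⟨hK⟩, -⟩ := exists_kernelPair f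
    obtain ⟨hc⟩ := h (PullbackCone.mk p q w) hK
    exact epi_of_isColimit_cofork hc

end RmkA31Model

/-! ### Transport along an equivalence of categories -/

section Transport

universe v₁ v₂ u₁ u₂

variable {C : Type u₁} [Category.{v₁} C] {D : Type u₂} [Category.{v₂} D]

/-- Components (Def. A.3: connected source, coprojection) are stable under post-composition with an
isomorphism. [cite: MochizukiSemiAnbd2006, Def A.3(i) p.82] -/
theorem IsComponent.comp_iso {X A A' : C} {ι : X ⟶ A} (h : IsComponent ι) (i : A ≅ A') :
    IsComponent (ι ≫ i.hom) := by
  obtain ⟨hX, B, κ, ⟨hc⟩⟩ := h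
  refine ⟨hX, B, κ ≫ i.hom, ⟨IsColimit.ofIsoColimit hc (Cocone.ext i ?_)⟩⟩
  rintro ⟨⟨⟩⟩ <;> rfl

/-- Components are preserved by (the functor of) an equivalence of categories.
[cite: MochizukiSemiAnbd2006, Def A.3(i) p.82] -/
theorem IsComponent.map_equivalence (e : C ≌ D) {X A : C} {ι : X ⟶ A} (h : IsComponent ι) :
    IsComponent (e.functor.map ι) := by
  obtain ⟨hX, B, κ, ⟨hc⟩⟩ := h
  exact ⟨TemperoidTransport.isConnectedObj_functor_obj e hX, e.functor.obj B, e.functor.map κ,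
    ⟨isColimitMapCoconeBinaryCofanEquiv e.functor ι κ (isColimitOfPreserves e.functor hc)⟩⟩

/-- 0-properness (every component of the target receives, over the arrow, an arrow from a component
of the source) is preserved by an equivalence of categories.
[cite: MochizukiSemiAnbd2006, Rmk A.3.1 p.82] -/
theorem zeroProper_map_equivalence (e : C ≌ D) {A B : C} (φ : A ⟶ B)
    (h : ∀ ⦃Y : C⦄ (κ : Y ⟶ B), IsComponent κ →
      ∃ (X : C) (ι : X ⟶ A) (k : X ⟶ Y), IsComponent ι ∧ ι ≫ φ = k ≫ κ) :
    ∀ ⦃Y' : D⦄ (κ' : Y' ⟶ e.functor.obj B), IsComponent κ' →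
      ∃ (X' : D) (ι' : X' ⟶ e.functor.obj A) (k' : X' ⟶ Y'),
        IsComponent ι' ∧ ι' ≫ e.functor.map φ = k' ≫ κ' := by
  intro Y' κ' hκ'
  have hκ : IsComponent (e.inverse.map κ' ≫ e.unitInv.app B) :=
    (hκ'.map_equivalence e.symm).comp_iso (e.unitIso.app B).symm
  obtain ⟨X, ι, k, hι, hcomm⟩ := h _ hκ
  refine ⟨e.functor.obj X, e.functor.map ι, e.functor.map k ≫ e.counit.app Y',
    hι.map_equivalence e, ?_⟩
  have n := e.counit.naturality κ'
  dsimp at n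
  erw [← e.functor.map_comp, hcomm, e.functor.map_comp, e.functor.map_comp,
    ← e.counit_app_functor]
  exact (congrArg (fun t => e.functor.map k ≫ t) n).trans (Category.assoc _ _ _).symm

/-- 0-properness is reflected by an equivalence of categories.
[cite: MochizukiSemiAnbd2006, Rmk A.3.1 p.82] -/
theorem zeroProper_of_map_equivalence (e : C ≌ D) {A B : C} (φ : A ⟶ B)
    (h : ∀ ⦃Y' : D⦄ (κ' : Y' ⟶ e.functor.obj B), IsComponent κ' →
      ∃ (X' : D) (ι' : X' ⟶ e.functor.obj A) (k' : X' ⟶ Y'),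
        IsComponent ι' ∧ ι' ≫ e.functor.map φ = k' ≫ κ') :
    ∀ ⦃Y : C⦄ (κ : Y ⟶ B), IsComponent κ →
      ∃ (X : C) (ι : X ⟶ A) (k : X ⟶ Y), IsComponent ι ∧ ι ≫ φ = k ≫ κ := by
  intro Y κ hκ
  obtain ⟨X', ι', k', hι', hcomm'⟩ := h _ (hκ.map_equivalence e)
  refine ⟨e.inverse.obj X', e.inverse.map ι' ≫ e.unitInv.app A,
    e.inverse.map k' ≫ e.unitInv.app Y, (hι'.map_equivalence e.symm).comp_iso (e.unitIso.app A).symm,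
    ?_⟩
  have n1 := e.unitInv.naturality φ
  have n2 := e.unitInv.naturality κ
  dsimp at n1 n2
  erw [Category.assoc, Category.assoc, ← n1, ← n2, ← Category.assoc, ← Category.assoc,
    ← e.inverse.map_comp, ← e.inverse.map_comp, hcomm']

end Transport

/-! ### Remark A.3.1 -/

open Literature.AlgebraicGeometry.Frobenioids.QuasiTemperoid (IsConnectedQuasiTemperoid BTempRel)

universe v₁ u u₁

/-- **Remark A.3.1, DISCHARGED** (SemiAnbd Appendix p. 82): for a morphism of QD-pairs
`f : (A, Γ_A) → (B, Γ_B)` of a connected quasi-temperoid `Q`, (a) `f` is 0-proper ⟺ (b) `A → B`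
is an epimorphism ⟺ (c) `B` is the colimit of the two projections `A ×_B A ⇉ A` (for every limit
kernel-pair cone).  Proof: in a chart `Q ≌ B^temp(Π, Π°)` all three say "`A → B` is surjective on
points" (`RmkA31Model.isZeroProper_iff_surjective`, `epi_iff_surjective`,
`epi_iff_forall_isColimit_cofork`), and each is transported along the equivalence (components and
0-properness: `zeroProper_map_equivalence` / `zeroProper_of_map_equivalence`; epimorphisms:
`Functor.epi_map_iff_epi`; limit pullback cones and coforks: Mathlib's
`isLimitPullbackConeMapOfIsLimit` / `isColimitOfIsColimitCoforkMap`, and the kernel pair of the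
model for the existence of a limit cone). [cite: MochizukiSemiAnbd2006, Rmk A.3.1 p.82] -/
theorem rmkA31_holds : RmkA31.{v₁, u, u₁} := by
  intro Q _ hQ P₁ P₂ f
  obtain ⟨G, _, _, _, H, -, -, ⟨e⟩⟩ := hQ.exists_equiv
  let F := e.functor
  -- the arrow of `f` in the model, as a morphism of QD-pairs with trivial groups
  let P₁' : QDPair (BTempRel G H) := ⟨F.obj P₁.A, ⊥⟩
  let P₂' : QDPair (BTempRel G H) := ⟨F.obj P₂.A, ⊥⟩
  let f' : QDPair.Hom P₁' P₂' := ⟨F.map f.hom, fun γ hγ => ⟨1, Subgroup.one_mem _, by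
    rw [Subgroup.mem_bot] at hγ
    subst hγ
    change F.map f.hom ≫ 𝟙 _ = 𝟙 _ ≫ F.map f.hom
    rw [Category.comp_id, Category.id_comp]⟩⟩
  have h1 : f.IsZeroProper ↔ Epi f.hom := by
    constructor
    · intro hz
      have hz' : f'.IsZeroProper := zeroProper_map_equivalence e f.hom hz
      have hsurj := (RmkA31Model.isZeroProper_iff_surjective f').mp hz'
      haveI : Epi (F.map f.hom) := RmkA31Model.epi_of_surjective (F.map f.hom) hsurj
      exact F.epi_of_epi_map inferInstance
    · intro hepi
      haveI := hepi
      have hsurj := RmkA31Model.surjective_of_epi (F.map f.hom)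
      have hz' : f'.IsZeroProper := (RmkA31Model.isZeroProper_iff_surjective f').mpr hsurj
      exact zeroProper_of_map_equivalence e f.hom hz'
  refine ⟨h1, ⟨fun hepi c hc => ?_, fun h => ?_⟩⟩
  · -- (b) ⇒ (c): transport the limit cone to the model, use the model, reflect the colimit
    haveI := hepi
    have hsurj := RmkA31Model.surjective_of_epi (F.map f.hom)
    have hc₁ : IsLimit (PullbackCone.mk c.fst c.snd c.condition) :=
      IsLimit.ofIsoLimit hc (PullbackCone.ext (Iso.refl _) (by exact (Category.id_comp _).symm)
        (by exact (Category.id_comp _).symm))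
    have hc' := isLimitPullbackConeMapOfIsLimit F c.condition hc₁
    obtain ⟨l⟩ := RmkA31Model.isColimit_cofork_of_surjective (F.map f.hom) hsurj _ hc'
    exact ⟨isColimitOfIsColimitCoforkMap F c.condition l⟩
  · -- (c) ⇒ (b): a limit kernel-pair cone exists (transported from the model)
    obtain ⟨K, p, q, w, ⟨hK⟩, -⟩ := RmkA31Model.exists_kernelPair (F.map f.hom)
    haveI : HasLimit (cospan (F.map f.hom) (F.map f.hom)) := HasLimit.mk ⟨_, hK⟩
    haveI : HasLimit (cospan f.hom f.hom ⋙ F) := hasLimit_of_iso (cospanCompIso F f.hom f.hom).symm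
    haveI : HasLimit (cospan f.hom f.hom) :=
      Adjunction.hasLimit_of_comp_equivalence (cospan f.hom f.hom) F
    obtain ⟨hcol⟩ := h (limit.cone (cospan f.hom f.hom)) (limit.isLimit _)
    exact epi_of_isColimit_cofork hcol

end Literature.AnabelianGeometry.SemiGraphs
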